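import Mathlib
import Summits.Ventures.PercRepro2.MergedUnionPA

/-!
# The reduction of (UNION-PA) to the one-sided pair (C_t, T*) (blind cell PercRepro2, mine-1 g34)

Row 2′CON-U's PA statement (UNION-PA): `λ̄(· | U)`, `U = {s ↮ X} ∪ {t ↮ Y}`, is positively
associated for `F, G` increasing in `C_s` and decreasing in `C_t`.  This file proves

  **(PAIR-t) ⟹ (UNION-PA)**  (`union_pa_of_pair`, with (PAIR-t) an explicit hypothesis),

where (PAIR-t) says that under `P(· | s ∉ T*)`, `T* = C_t ∪ (C_X if t ↔ Y)`, the pair `(C_t, T*)`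
is positively associated in the product order (here in the form: for `Φ, Ψ` antitone in both
arguments, `E[Φ 1_Q] E[Ψ 1_Q] ≤ E[Φ Ψ 1_Q] P(Q)`).  The mechanism: given `T* = D` the two plain
clusters are conditionally INDEPENDENT — `C_s` is fresh product percolation on `G ∖ D`
(`expect_pair_stat_mul_indicator`, the tower identity over the pair statistic `(T*, C_t)`), `C_t` is
the `t`-component inside `D`; Harris in the `C_s`-fibre and (PAIR-t) for the decreasing
fibre-mean pair close.  (PAIR-t) itself is BHK06 Theorem 1.1 for the pair (cluster, merged cluster)
of `t` on the ghost graph `G + (X → z → Y)` (proofs/MINE1-MERGEDPA.md §10, Theorem B) — its Lean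
proof is the four-function induction for a pair and is not in this file.
-/

namespace Summit.Ventures.PercRepro2

namespace MergedU

section Reduce

variable {V : Type*} {E : Type*} [Fintype E] [DecidableEq E] [Fintype V] [DecidableEq V]
  {R : Type*} [Field R] [LinearOrder R] [IsStrictOrderedRing R] [Archimedean R]
  {p : E → R} (ends : E → Sym2 V) (s t : V) (X Y : Set V)

omit [Fintype E] [DecidableEq E] [Fintype V] [DecidableEq V] in
/-- The level sets of the pair statistic `(T*, C_t)` are determined by the edges touching `T*`. -/
lemma dependsOn_pairEvent (D D₀ : Set V) :
    DependsOn (· ∈ {ω : Config E | merged ends ω t Y X = D ∧ cluster ends ω t = D₀})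
      (touches ends D) := by
  intro ω ω' h
  have key : ∀ {ω ω' : Config E}, (∀ e ∈ touches ends D, ω e = ω' e) →
      merged ends ω t Y X = D ∧ cluster ends ω t = D₀ →
      merged ends ω' t Y X = D ∧ cluster ends ω' t = D₀ := by
    intro ω ω' h ⟨hD, hD₀⟩
    refine ⟨merged_eq_of_eqOn_touches h hD, ?_⟩
    have hsub : D₀ ⊆ D := hD₀ ▸ hD ▸ cluster_subset_merged ω t Y X
    exact cluster_eq_of_eqOn_touches (fun e he => h e (touches_mono hsub he)) hD₀
  exact propext ⟨key h, key fun e he => (h e he).symm⟩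

omit [DecidableEq V] [LinearOrder R] [IsStrictOrderedRing R] [Archimedean R] in
/-- **Tower identity over the pair `(T*, C_t)`**: on `{s ∉ T*}` the cluster of `s` is fresh
product percolation on `G ∖ T*`, independent of `C_t`:
`E[Φ(T*, C_t, C_s) 1_Q] = E[E_{ω'}[Φ(T*, C_t, C_s(delConfig T* ω'))] 1_Q]`. -/
theorem expect_pair_stat_mul_indicator (Φ : Set V → Set V → Set V → R) :
    expect p (fun ω => Φ (merged ends ω t Y X) (cluster ends ω t) (cluster ends ω s) *
        ({ω : Config E | s ∉ merged ends ω t Y X}).indicator 1 ω) =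
      expect p (fun ω => expect p (fun ω' => Φ (merged ends ω t Y X) (cluster ends ω t)
        (cluster ends (delConfig ends (merged ends ω t Y X) ω') s)) *
        ({ω : Config E | s ∉ merged ends ω t Y X}).indicator 1 ω) := by
  classical
  let c : Set V → R := fun D => ({D' : Set V | s ∉ D'}.indicator 1 D)
  let K : Set V × Set V → Config E → R := fun P ω =>
    Φ P.1 P.2 (cluster ends (delConfig ends P.1 ω) s)
  let Ψ : Set V × Set V → Config E → R := fun P ω => c P.1 * K P ω
  let S : Config E → Set V × Set V := fun ω => (merged ends ω t Y X, cluster ends ω t)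
  have hΨ : ∀ P, DependsOn (Ψ P) (touches ends P.1)ᶜ := by
    intro P ω ω' h
    simp only [Ψ, K]
    rw [delConfig_congr h]
  have hS : ∀ P : Set V × Set V, DependsOn (· ∈ {ω : Config E | S ω = P}) (touches ends P.1) := by
    intro P
    have e : {ω : Config E | S ω = P} =
        {ω : Config E | merged ends ω t Y X = P.1 ∧ cluster ends ω t = P.2} := by
      ext ω
      simp only [Set.mem_setOf_eq, S, Prod.ext_iff]
    rw [e]
    exact dependsOn_pairEvent ends t X Y P.1 P.2
  have hdisj : ∀ P : Set V × Set V, Disjoint (touches ends P.1) (touches ends P.1)ᶜ :=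
    fun P => disjoint_compl_right
  have hpt : ∀ ω, Φ (merged ends ω t Y X) (cluster ends ω t) (cluster ends ω s) *
      ({ω : Config E | s ∉ merged ends ω t Y X}).indicator (1 : Config E → R) ω = Ψ (S ω) ω := by
    intro ω
    simp only [Ψ, c, K, S]
    by_cases hst : s ∈ merged ends ω t Y X
    · rw [Set.indicator_of_notMem (show ω ∉ {ω : Config E | s ∉ merged ends ω t Y X} from
          fun h => h hst),
        Set.indicator_of_notMem (show merged ends ω t Y X ∉ {D' : Set V | s ∉ D'} from
          fun h => h hst)]
      simp
    · rw [Set.indicator_of_mem (show ω ∈ {ω : Config E | s ∉ merged ends ω t Y X} from hst),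
        Set.indicator_of_mem (show merged ends ω t Y X ∈ {D' : Set V | s ∉ D'} from hst),
        cluster_delConfig_of_closedOff (fun _ hu => cluster_subset_merged_of_mem hu) hst]
      simp
  have hΨexp : ∀ P, expect p (Ψ P) = c P.1 * expect p (K P) := by
    intro P
    simp only [Ψ]
    rw [expect_const_mul]
  have e1 : (fun ω => Φ (merged ends ω t Y X) (cluster ends ω t) (cluster ends ω s) *
      ({ω : Config E | s ∉ merged ends ω t Y X}).indicator (1 : Config E → R) ω) =
      fun ω => Ψ (S ω) ω :=
    funext hpt
  rw [e1, expect_tower p hdisj (S := S) hS hΨ]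
  simp only [hΨexp]
  unfold expect
  refine Finset.sum_congr rfl fun ω _ => ?_
  simp only [c, K, S]
  by_cases hst : s ∈ merged ends ω t Y X
  · rw [Set.indicator_of_notMem (show merged ends ω t Y X ∉ {D' : Set V | s ∉ D'} from
        fun h => h hst),
      Set.indicator_of_notMem (show ω ∉ {ω : Config E | s ∉ merged ends ω t Y X} from
        fun h => h hst)]
    simp
  · rw [Set.indicator_of_mem (show merged ends ω t Y X ∈ {D' : Set V | s ∉ D'} from hst),
      Set.indicator_of_mem (show ω ∈ {ω : Config E | s ∉ merged ends ω t Y X} from hst)]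
    simp

omit [DecidableEq V] [Archimedean R] in
/-- **(PAIR-t) ⟹ (UNION-PA).**  Hypothesis `hpair` = positive association of the pair `(C_t, T*)`
under `P(· | s ∉ T*)` for bounded nonnegative functionals antitone in both arguments.  Conclusion:
for `F, G` increasing in `C_s` and decreasing in `C_t`, `0 ≤ F, G ≤ M`,
`E[F(C_s,C_t) 1_Q] · E[G(C_s,C_t) 1_Q] ≤ E[(F G)(C_s,C_t) 1_Q] · P(Q)`, `Q = {s ∉ T*} = {s ↮ t} ∩ U`. -/
theorem union_pa_of_pair (hp : IsProbVec p)
    (hpair : ∀ (Φ Ψ : Set V → Set V → R) (M' : R),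
      (∀ ⦃D₀ D₀' D D' : Set V⦄, D₀ ⊆ D₀' → D ⊆ D' → Φ D₀' D' ≤ Φ D₀ D) →
      (∀ ⦃D₀ D₀' D D' : Set V⦄, D₀ ⊆ D₀' → D ⊆ D' → Ψ D₀' D' ≤ Ψ D₀ D) →
      (∀ D₀ D, 0 ≤ Φ D₀ D) → (∀ D₀ D, 0 ≤ Ψ D₀ D) → (∀ D₀ D, Φ D₀ D ≤ M') →
      (∀ D₀ D, Ψ D₀ D ≤ M') →
      expect p (fun ω => Φ (cluster ends ω t) (merged ends ω t Y X) *
          ({ω : Config E | s ∉ merged ends ω t Y X}).indicator 1 ω) *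
        expect p (fun ω => Ψ (cluster ends ω t) (merged ends ω t Y X) *
          ({ω : Config E | s ∉ merged ends ω t Y X}).indicator 1 ω) ≤
      expect p (fun ω => Φ (cluster ends ω t) (merged ends ω t Y X) *
          Ψ (cluster ends ω t) (merged ends ω t Y X) *
          ({ω : Config E | s ∉ merged ends ω t Y X}).indicator 1 ω) *
        prob p {ω : Config E | s ∉ merged ends ω t Y X})
    {F G : Set V → Set V → R}
    (hF : ∀ ⦃W W' C C' : Set V⦄, W ⊆ W' → C' ⊆ C → F W C ≤ F W' C')
    (hG : ∀ ⦃W W' C C' : Set V⦄, W ⊆ W' → C' ⊆ C → G W C ≤ G W' C')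
    (hF0 : ∀ W C, 0 ≤ F W C) (hG0 : ∀ W C, 0 ≤ G W C) {M : R} (hFM : ∀ W C, F W C ≤ M)
    (hGM : ∀ W C, G W C ≤ M) :
    expect p (fun ω => F (cluster ends ω s) (cluster ends ω t) *
        ({ω : Config E | s ∉ merged ends ω t Y X}).indicator 1 ω) *
      expect p (fun ω => G (cluster ends ω s) (cluster ends ω t) *
        ({ω : Config E | s ∉ merged ends ω t Y X}).indicator 1 ω) ≤
    expect p (fun ω => F (cluster ends ω s) (cluster ends ω t) *
        G (cluster ends ω s) (cluster ends ω t) *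
        ({ω : Config E | s ∉ merged ends ω t Y X}).indicator 1 ω) *
      prob p {ω : Config E | s ∉ merged ends ω t Y X} := by
  -- the fibre means `F̃(D₀, D) = E_{ω'} F(C_s(delConfig D ω'), D₀)`
  set Ft : Set V → Set V → R := fun D₀ D =>
    expect p (fun ω' => F (cluster ends (delConfig ends D ω') s) D₀) with hFt
  set Gt : Set V → Set V → R := fun D₀ D =>
    expect p (fun ω' => G (cluster ends (delConfig ends D ω') s) D₀) with hGt
  have hFta : ∀ ⦃D₀ D₀' D D' : Set V⦄, D₀ ⊆ D₀' → D ⊆ D' → Ft D₀' D' ≤ Ft D₀ D :=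
    fun D₀ D₀' D D' h₀ h => expect_mono hp fun ω' =>
      hF (cluster_mono (ends := ends) (delConfig_anti h ω') s) h₀
  have hGta : ∀ ⦃D₀ D₀' D D' : Set V⦄, D₀ ⊆ D₀' → D ⊆ D' → Gt D₀' D' ≤ Gt D₀ D :=
    fun D₀ D₀' D D' h₀ h => expect_mono hp fun ω' =>
      hG (cluster_mono (ends := ends) (delConfig_anti h ω') s) h₀
  have hFt0 : ∀ D₀ D, 0 ≤ Ft D₀ D := fun _ _ => expect_nonneg hp fun _ => hF0 _ _
  have hGt0 : ∀ D₀ D, 0 ≤ Gt D₀ D := fun _ _ => expect_nonneg hp fun _ => hG0 _ _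
  have hFtM : ∀ D₀ D, Ft D₀ D ≤ M := fun _ _ => expect_le_of_le hp fun _ => hFM _ _
  have hGtM : ∀ D₀ D, Gt D₀ D ≤ M := fun _ _ => expect_le_of_le hp fun _ => hGM _ _
  have key := hpair Ft Gt M hFta hGta hFt0 hGt0 hFtM hGtM
  -- the tower identities
  have tF := expect_pair_stat_mul_indicator (p := p) ends s t X Y (fun _ D₀ W => F W D₀)
  have tG := expect_pair_stat_mul_indicator (p := p) ends s t X Y (fun _ D₀ W => G W D₀)
  have tFG := expect_pair_stat_mul_indicator (p := p) ends s t X Y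
    (fun _ D₀ W => F W D₀ * G W D₀)
  rw [tF, tG, tFG]
  -- Harris in the fibre `G ∖ D`
  have hpt : ∀ ω, Ft (cluster ends ω t) (merged ends ω t Y X) *
      Gt (cluster ends ω t) (merged ends ω t Y X) *
      ({ω : Config E | s ∉ merged ends ω t Y X}).indicator (1 : Config E → R) ω ≤
      expect p (fun ω' =>
        F (cluster ends (delConfig ends (merged ends ω t Y X) ω') s) (cluster ends ω t) *
        G (cluster ends (delConfig ends (merged ends ω t Y X) ω') s) (cluster ends ω t)) *
        ({ω : Config E | s ∉ merged ends ω t Y X}).indicator 1 ω := by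
    intro ω
    refine mul_le_mul_of_nonneg_right ?_ (Set.indicator_apply_nonneg fun _ => zero_le_one)
    apply expect_mul_expect_le_expect_mul hp
    · intro ω₁ ω₂ h
      exact hF (cluster_mono (ends := ends) (delConfig_mono_config _ h) s) (subset_refl _)
    · intro ω₁ ω₂ h
      exact hG (cluster_mono (ends := ends) (delConfig_mono_config _ h) s) (subset_refl _)
  have hmono := expect_mono hp hpt
  have hQ0 : 0 ≤ prob p {ω : Config E | s ∉ merged ends ω t Y X} := prob_nonneg hp _
  exact key.trans (mul_le_mul_of_nonneg_right hmono hQ0)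

end Reduce

end MergedU

end Summit.Ventures.PercRepro2
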